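import Literature.IUT.LogThetaLattice.GlobalKummerNonInterference
import Literature.IUT.LogThetaLattice.GlobalKummerNonInterferenceProofs
import Literature.IUT.LogThetaLattice.LocalLogShells
import Literature.IUT.LogThetaLattice.TensorPackets
import Mathlib.RingTheory.DedekindDomain.AdicValuation
import Mathlib.GroupTheory.Torsion
import Mathlib.GroupTheory.GroupAction.Quotient
import HarnessLib

/-!
# [IUTchIII] Proposition 3.10 (ii) at the places model — the junctions of its second paragraph
# (proof-only companion №3 of `GlobalKummerNonInterference.lean`; DAG node **IUTchIII:Prop3.10(ii)**)

Proof-only companion (abc-iut cell, block C / wave W6, seat abc-iut-w6-d079; CONE-BOARD row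
IUTchIII:Prop3.10(ii); residuals (J1), (J2) named by abc-iut-L6-d4's clause-coverage census, STATUS
2026-08-26T06:23:43Z) of the FROZEN statement file `Literature/IUT/LogThetaLattice/GlobalKummerNonInterference.lean`
(abc-iut-L6-t4, p404134 … p407875) and its companions `…Proofs` (abc-iut-L6-t5, p405475: the PLACES MODEL
`localMonoidsDetectIntegrality_places`, `Prop310ii_nonInterference_places`) and `…Proofs2` (abc-iut-w4-d002,
p411539: `Prop310ii_logKummer'_of_kummerTransport`, whose hypothesis `hRel` "at the log-link relation" was left
open). S. Mochizuki, *Inter-universal Teichmüller theory III*, kurims manuscript (May 2020) of PRIMS **57** (2021),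
§3, Proposition 3.10 (ii) "(Non-interference with Local Integers)", p. 148 l. 87 – p. 149 l. 12, proof p. 149
l. 42–48 [claim: Mochizuki2012, status: disputed] (D-0012 claim key). NO new definitions; no side taken on
[IUTchIII] Cor. 3.12; typed ≠ proved elsewhere; instantiated ≠ endorsed.

PRINTED TEXT (ii), second paragraph (p. 148 l. 102 – p. 149 l. 12): the groups `(^{n,m}𝕄⊛_MOD)_j` "[of nonzero
elements of a number field]" act on the modules `𝓘^ℚ(^{S^±_{j+1}}𝓕(^{n,∘}𝔇_≻)_{𝕍_ℚ})` "not via a single Kummer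
isomorphism as in (i), but rather via the totality of the various pre-composites of Kummer isomorphisms with
iterates [cf. Remark 1.1.1] of the log-links … — where we observe that these actions are mutually compatible up
to [harmless!] 'identity indeterminacies' at an adjacent '`m`', precisely as a consequence of the equality of the
first display of the present (ii) [cf. the discussion of Remark 1.2.3, (ii); the discussion of Definition 1.1,
(ii), concerning quotients by '`Ψ^{μ_N}_{†𝓕_v}`' at `v ∈ 𝕍^arc`; the discussion of Definition 1.1, (iv), at
`v ∈ 𝕍^non`] … one obtains a sort of 'log-Kummer correspondence' … which is invariant with respect to the
translation symmetries [cf. Proposition 1.3, (iv)] of the `n`-th column". Def. 1.1 (iv), p. 27: "these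
constructions only require the perfection '`(−)^pf`' of the units and are manifestly unaffected by the operation
of forming the quotient by a torsion subgroup of the units". Rmk. 1.1.1 (i), p. 28: the log-links in such
iterates "are to be understood as being defined only on the [local] units … defined only on the product [indexed
by the set of all valuations of the number field] of the groups of local units". First display, p. 148:
`(†𝕄⊛_MOD)_α ∩ Π_{v∈𝕍} Ψ_{log(^{A,α}𝓕_v)} = (†𝕄⊛μ_MOD)_α (⊆ Π_{v∈𝕍} 𝓘^ℚ(^{A,α}𝓕_v) = Π_{v_ℚ∈𝕍_ℚ} 𝓘^ℚ(^A𝓕_{v_ℚ}))`.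

WHAT IS PROVED (at abc-iut-L6-t5's places model of the local monoids of a number field `K`: `𝕍 := {finite
places} ⊔ {complex embeddings}`, `Ψ_v` = nonzero `v`-integers / nonzero `x` with `|φ(x)| ≤ 1`; classical):

* `valuation_eq_one_…`, `norm_embedding_eq_one_…`, `isOfFinOrder_…_of_mem_localMonoids_places` — an element
  lying in EVERY local monoid (= in the product of the domains of the log-links, Rmk. 1.1.1 (i)) is a UNIT at
  every place and a torsion unit (Rmk. 1.2.3 (ii) p. 39; the first display via p405475 + Kronecker p404134).
* **(J1)** `Prop310ii_logKummer'_of_torsionTrivial_places` — the corrected per-index typing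
  `Prop310ii_logKummer'` (statement file v3) HOLDS for the actions of the groups `(^{n,m}𝕄⊛_MOD)_j^× = (K m)ˣ`
  through the Kummer isomorphisms `κ_m` of (i) and ANY coric action `ρ` "unaffected by … the quotient by a
  torsion subgroup of the units" (Def. 1.1 (iv): `ρ` kills torsion — the printed "identity indeterminacy"), for
  EVERY relation `Rel` between the `m`-th and `(m+1)`-th copies SUPPORTED ON THE DOMAINS OF THE LOG-LINKS (Rmk.
  1.1.1 (i)) — "precisely as a consequence of the equality of the first display": such elements are roots of
  unity, on which `ρ` is the identity. `Prop310ii_logKummer'_modTorsion_places` — everything instantiated: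
  `ρ` := multiplication on the `×μ`-quotient `Kˣ/(torsion)` (the "`×μ`" of Def. 1.1 (iv) / [IUTchII] Def. 4.9),
  `Rel` := "both elements lie in every local monoid" (the reading of `Rel` used for Prop. 3.5 (ii) (c) at the
  bad-place model, `VerticallyCoricLGPBad` p412771). Print supports equality of the two actions MODULO the
  identity indeterminacy, not equality of Kummer images — hence this form rather than p411539's `hRel`.
* **(J1′)** `log_eq_zero_of_mem_localMonoids_places` (+ `exists_unit_valuationSubring_eq_…`,
  `adicCompletion_log_eq_zero_…`, `exists_unit_adicCompletionIntegers_eq_…`) — "indeterminacies at `m` that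
  correspond, via the log-link, to 'addition by zero' … at `m + 1`" (Prop. 3.5 (ii) (c) p. 106, the local form
  of the same sentence; Rmk. 1.2.3 (i)): at EVERY nonarchimedean localization (any valuation ring `O` of any
  field receiving `K`, in particular `𝒪_{K_v} ⊆ K_v = v.adicCompletion K`) such an element is a unit of `O` and
  EVERY logarithm `O^× → (k, +)` (abc-iut-L6-t3's abstract `logk`, `LocalLogShells`) sends it to `0`
  (`log_eq_zero_of_pow_eq_one`, p403834, BY NAME).
* **(J2)** the parenthetical inclusion `(†𝕄⊛μ_MOD)_α ⊆ Π_{v∈𝕍} 𝓘^ℚ(^{A,α}𝓕_v)` factor by factor at the number-field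
  level: nonarchimedean factor `algebraMap_adicCompletion_mem_integers_of_mem_localMonoids_places` (the element
  lands in `𝒪_{K_v}`; `𝒪_{K_v} ⊆ 𝓘_{K_v}` is Rmk. 1.2.2 (i) (b^non) = abc-iut-L6-t3's `IntegersSubsetLogShell` /
  abc-iut-L4-t3's `closedBall_subset_logShell`, and `𝓘^ℚ = K_v` is p412771's `shellQSpan_closure_logShell_eq_top`
  — cited BY NAME, not re-proved); ARCHIMEDEAN factor `embedding_mem_arcLogShell_of_mem_localMonoids_places`
  (`𝒪_k^× ⊆ 𝒪_k ⊆ 𝓘_k = {|a| ≤ π}`, Rmk. 1.2.2 (ii)), `arcShellQSpan_eq_top` (`𝓘^ℚ_k = ℂ`: the span — abc-iut-L6-t4's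
  `shellQSpan`, read over `ℝ` as its docstring prescribes for the closed ball of a normed `ℝ`-space — of the
  archimedean log-shell is the whole field) and `embedding_mem_arcShellQSpan_of_mem_localMonoids_places`.

HONEST SCOPE. One number field `K` stands for the coric `𝕄⊛_MOD(^{n,∘}𝓗𝓣^𝒟)_j` with its places model; the
Frobenius-like copies `(^{n,m}𝕄⊛_MOD)_j = K m` enter through abstract field isomorphisms `κ_m` (the Kummer
isomorphisms of (i), an OUTPUT SIGNATURE — `VerticallyCoricGlobalData.kummerField`); the tensor-packet modules
`𝓘^ℚ(…)_{𝕍_ℚ}` are replaced by an arbitrary coric `X` with a torsion-trivial action (J1) and by the one-factor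
log-shells of `LocalLogShells` (J2); packet versions are images under abc-iut-L6-t4's `toPacketAt`, not spelled
out. Nothing here bears on the disputed [IUTchIII] Cor. 3.12. [claim: Mochizuki2012, status: disputed] for every
quoted sentence; the mathematics is Kronecker's theorem (already in the tree) plus elementary bookkeeping.
-/

noncomputable section

namespace Literature.IUT.LogThetaLattice

open NumberField IsDedekindDomain

universe u v

section UnitsAtAllPlaces

variable {K : Type u} [Field K] [NumberField K]

/-- **[IUTchIII] Prop. 3.10 (ii), first display / Rmk. 1.2.3 (ii)** (p. 148; p. 39 "being a unit at all
`v ∈ 𝕍̲` corresponds precisely … to the case where `f` is a root of unity"), places model: an element of the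
number field lying in every local monoid (nonzero `v`-integers at the finite places, `|φ(x)| ≤ 1` at the
complex embeddings) is a ROOT OF UNITY — the first display read elementwise (p405475
`localMonoidsDetectIntegrality_places` + Kronecker `integralAtAllPlaces_iff_rootOfUnity`, BY NAME).
[claim: Mochizuki2012, status: disputed] -/
theorem exists_pow_eq_one_of_mem_localMonoids_places {x : K}
    (hx : ∀ v : HeightOneSpectrum (𝓞 K) ⊕ (K →+* ℂ),
      x ∈ Sum.elim (fun w => {x : K | x ≠ 0 ∧ w.valuation K x ≤ 1})
        (fun φ => {x : K | x ≠ 0 ∧ ‖φ x‖ ≤ 1}) v) :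
    x ≠ 0 ∧ ∃ n : ℕ, 0 < n ∧ x ^ n = 1 := by
  obtain ⟨hx0, hint⟩ := ((localMonoidsDetectIntegrality_places K) x).mp hx
  exact ⟨hx0, (integralAtAllPlaces_iff_rootOfUnity K hx0).mp hint⟩

/-- Places model, finite places: an element lying in every local monoid has `v`-adic valuation EXACTLY `1` at
every finite place `v` — it is a local UNIT, i.e. lies in the domain of the log-link at `v` ([IUTchIII] Rmk.
1.1.1 (i) p. 28: the log-links "are to be understood as being defined only on the [local] units").
[claim: Mochizuki2012, status: disputed] -/
theorem valuation_eq_one_of_mem_localMonoids_places {x : K}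
    (hx : ∀ v : HeightOneSpectrum (𝓞 K) ⊕ (K →+* ℂ),
      x ∈ Sum.elim (fun w => {x : K | x ≠ 0 ∧ w.valuation K x ≤ 1})
        (fun φ => {x : K | x ≠ 0 ∧ ‖φ x‖ ≤ 1}) v)
    (v : HeightOneSpectrum (𝓞 K)) : v.valuation K x = 1 := by
  obtain ⟨-, n, hn, hxn⟩ := exists_pow_eq_one_of_mem_localMonoids_places hx
  have hle : v.valuation K x ≤ 1 := (hx (Sum.inl v)).2
  refine le_antisymm hle (not_lt.mp fun hlt => ?_)
  have h1 : v.valuation K x ^ n = 1 := by rw [← map_pow, hxn, map_one]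
  exact absurd h1 (pow_lt_one' hlt hn.ne').ne

/-- Places model, archimedean places: an element lying in every local monoid has absolute value EXACTLY `1`
under every complex embedding — it lies in `𝒪_k^× = {|a| = 1}` ([IUTchIII] Rmk. 1.2.2 (ii) p. 36), the
domain of the archimedean log-link. [claim: Mochizuki2012, status: disputed] -/
theorem norm_embedding_eq_one_of_mem_localMonoids_places {x : K}
    (hx : ∀ v : HeightOneSpectrum (𝓞 K) ⊕ (K →+* ℂ),
      x ∈ Sum.elim (fun w => {x : K | x ≠ 0 ∧ w.valuation K x ≤ 1})
        (fun φ => {x : K | x ≠ 0 ∧ ‖φ x‖ ≤ 1}) v)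
    (φ : K →+* ℂ) : ‖φ x‖ = 1 := by
  obtain ⟨-, n, hn, hxn⟩ := exists_pow_eq_one_of_mem_localMonoids_places hx
  have h1 : ‖φ x‖ ^ n = 1 := by rw [← norm_pow, ← map_pow, hxn, map_one, norm_one]
  exact (pow_eq_one_iff_of_nonneg (norm_nonneg _) hn.ne').mp h1

/-- Places model: an element lying in every local monoid is a TORSION element of `Kˣ` — it lies in the
subgroup `(†𝕄⊛μ_MOD)_α ⊆ (†𝕄⊛_MOD)_α` "of torsion elements, i.e., roots of unity" (p. 148).
[claim: Mochizuki2012, status: disputed] -/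
theorem isOfFinOrder_mk0_of_mem_localMonoids_places {x : K}
    (hx : ∀ v : HeightOneSpectrum (𝓞 K) ⊕ (K →+* ℂ),
      x ∈ Sum.elim (fun w => {x : K | x ≠ 0 ∧ w.valuation K x ≤ 1})
        (fun φ => {x : K | x ≠ 0 ∧ ‖φ x‖ ≤ 1}) v)
    (hx0 : x ≠ 0) : IsOfFinOrder (Units.mk0 x hx0) := by
  obtain ⟨-, n, hn, hxn⟩ := exists_pow_eq_one_of_mem_localMonoids_places hx
  exact isOfFinOrder_iff_pow_eq_one.mpr ⟨n, hn, Units.ext (by simp [hxn])⟩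

/-- Unit form of the previous statement: a unit `g ∈ Kˣ` whose underlying element lies in every local monoid is
of finite order. [claim: Mochizuki2012, status: disputed] -/
theorem isOfFinOrder_of_mem_localMonoids_places {g : Kˣ}
    (hg : ∀ v : HeightOneSpectrum (𝓞 K) ⊕ (K →+* ℂ),
      (g : K) ∈ Sum.elim (fun w => {x : K | x ≠ 0 ∧ w.valuation K x ≤ 1})
        (fun φ => {x : K | x ≠ 0 ∧ ‖φ x‖ ≤ 1}) v) : IsOfFinOrder g := by
  have h := isOfFinOrder_mk0_of_mem_localMonoids_places hg g.ne_zero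
  rwa [Units.mk0_val] at h

end UnitsAtAllPlaces

/-! ### (J1) The log-Kummer correspondence of (ii), second paragraph, at the places model -/

section LogKummerPlaces

variable {K : ℤ → Type u} [∀ m, Field (K m)] {Kc : Type u} [Field Kc] [NumberField Kc]

/-- **(J1) [IUTchIII] Prop. 3.10 (ii), second paragraph (p. 148 l. 102 – p. 149 l. 12)** — the corrected
per-index typing `Prop310ii_logKummer'` HOLDS at the places model: let the groups `(^{n,m}𝕄⊛_MOD)_j^× = (K m)ˣ`
act on a coric `X` through the Kummer isomorphisms `κ_m` of (i) (pre-composites, p. 148) and a coric action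
`ρ` of `(Kc)ˣ` that is "manifestly unaffected by the operation of forming the quotient by a torsion subgroup
of the units" (Def. 1.1 (iv) p. 27; the archimedean "quotients by `Ψ^{μ_N}`", Def. 1.1 (ii)) — `hρ`: `ρ`
kills torsion, the printed "[harmless!] identity indeterminacy"; and let `Rel` be ANY relation between the
`m`-th and `(m+1)`-th copies supported on the domains of the log-links (Rmk. 1.1.1 (i): both members lie,
through their Kummer images, in every local monoid `Ψ_v`, `v ∈ 𝕍`). Then (1) every copy has the same image
in `Aut(X)` ("invariant with respect to the translation symmetries … of the `n`-th column") and (2) related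
elements act IDENTICALLY — "mutually compatible up to [harmless!] 'identity indeterminacies' at an adjacent
'`m`', precisely as a consequence of the equality of the first display": such elements are roots of unity
(p405475/p404134), on which `ρ` is the identity. PROVED. [claim: Mochizuki2012, status: disputed] -/
theorem Prop310ii_logKummer'_of_torsionTrivial_places (κ : ∀ m, K m ≃+* Kc) {X : Type u}
    (ρ : Kcˣ →* Equiv.Perm X) (hρ : ∀ u : Kcˣ, IsOfFinOrder u → ρ u = 1)
    (Rel : ∀ m, (K m)ˣ → (K (m + 1))ˣ → Prop)
    (hRel : ∀ m (g : (K m)ˣ) (g' : (K (m + 1))ˣ), Rel m g g' →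
      (∀ v : HeightOneSpectrum (𝓞 Kc) ⊕ (Kc →+* ℂ),
        (κ m (g : K m) : Kc) ∈ Sum.elim (fun w => {x : Kc | x ≠ 0 ∧ w.valuation Kc x ≤ 1})
          (fun φ => {x : Kc | x ≠ 0 ∧ ‖φ x‖ ≤ 1}) v) ∧
      (∀ v : HeightOneSpectrum (𝓞 Kc) ⊕ (Kc →+* ℂ),
        (κ (m + 1) (g' : K (m + 1)) : Kc) ∈ Sum.elim (fun w => {x : Kc | x ≠ 0 ∧ w.valuation Kc x ≤ 1})
          (fun φ => {x : Kc | x ≠ 0 ∧ ‖φ x‖ ≤ 1}) v)) :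
    Literature.IUT.LogThetaLattice.Prop310ii_logKummer' (fun m => (K m)ˣ)
      (fun m => ρ.comp (Units.mapEquiv (κ m).toMulEquiv).toMonoidHom) Rel := by
  refine ⟨fun m => ?_, fun m g g' hgg' => ?_⟩
  · have hr : ∀ n, Set.range ⇑(ρ.comp (Units.mapEquiv (κ n).toMulEquiv).toMonoidHom) = Set.range ρ :=
      fun n => by
        rw [MonoidHom.coe_comp]
        exact (Units.mapEquiv (κ n).toMulEquiv).surjective.range_comp ρ
    rw [hr m, hr (m + 1)]
  · obtain ⟨hg, hg'⟩ := hRel m g g' hgg'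
    have h1 : IsOfFinOrder (Units.mapEquiv (κ m).toMulEquiv g) :=
      isOfFinOrder_of_mem_localMonoids_places (K := Kc) (by simpa [Units.coe_mapEquiv] using hg)
    have h2 : IsOfFinOrder (Units.mapEquiv (κ (m + 1)).toMulEquiv g') :=
      isOfFinOrder_of_mem_localMonoids_places (K := Kc) (by simpa [Units.coe_mapEquiv] using hg')
    simp only [MonoidHom.coe_comp, Function.comp_apply, MulEquiv.coe_toMonoidHom]
    rw [hρ _ h1, hρ _ h2]

omit [NumberField Kc] in
/-- The coric action "unaffected by … the quotient by a torsion subgroup of the units" made EXPLICIT: the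
multiplication action of `(Kc)ˣ` on its `×μ`-quotient `Kc^{×μ} := (Kc)ˣ/(torsion)` ([IUTchIII] Def. 1.1 (iv);
the "`×μ`" of [IUTchII] Def. 4.9) kills every torsion unit. PROVED. [claim: Mochizuki2012, status: disputed] -/
theorem toPermHom_modTorsion_eq_one_of_isOfFinOrder (u : Kcˣ) (hu : IsOfFinOrder u) :
    MulAction.toPermHom Kcˣ (Kcˣ ⧸ CommGroup.torsion Kcˣ) u = 1 := by
  ext q
  induction q using QuotientGroup.induction_on with
  | H x =>
    show ((u • (x : Kcˣ ⧸ CommGroup.torsion Kcˣ) : Kcˣ ⧸ CommGroup.torsion Kcˣ)) = x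
    rw [MulAction.Quotient.smul_coe, smul_eq_mul, QuotientGroup.eq, mul_inv_rev, mul_assoc,
      mul_comm u⁻¹ x, inv_mul_cancel_left]
    exact (CommGroup.mem_torsion _).mpr hu.inv

/-- **(J1, explicit instance) [IUTchIII] Prop. 3.10 (ii), second paragraph**, places model with EVERYTHING
instantiated: the groups `(K m)ˣ` act, through the Kummer isomorphisms `κ_m` of (i), by multiplication on the
`×μ`-quotient `(Kc)ˣ/(torsion)` of the coric copy (Def. 1.1 (iv)); `Rel m g g'` := "both `g` (at `m`) and `g'`
(at `m + 1`) lie in the domains of the log-links", i.e. their Kummer images lie in every local monoid `Ψ_v`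
(Rmk. 1.1.1 (i); the reading of `Rel` used for Prop. 3.5 (ii) (c) at the bad-place model, p412771). Then
`Prop310ii_logKummer'` HOLDS: translation invariance of the Kummer images and "mutual compatibility up to
identity indeterminacies at an adjacent `m`" — a consequence of the first display (roots of unity). PROVED.
[claim: Mochizuki2012, status: disputed] -/
theorem Prop310ii_logKummer'_modTorsion_places (κ : ∀ m, K m ≃+* Kc) :
    Literature.IUT.LogThetaLattice.Prop310ii_logKummer' (fun m => (K m)ˣ)
      (fun m => (MulAction.toPermHom Kcˣ (Kcˣ ⧸ CommGroup.torsion Kcˣ)).comp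
        (Units.mapEquiv (κ m).toMulEquiv).toMonoidHom)
      (fun m g g' =>
        (∀ v : HeightOneSpectrum (𝓞 Kc) ⊕ (Kc →+* ℂ),
          (κ m (g : K m) : Kc) ∈ Sum.elim (fun w => {x : Kc | x ≠ 0 ∧ w.valuation Kc x ≤ 1})
            (fun φ => {x : Kc | x ≠ 0 ∧ ‖φ x‖ ≤ 1}) v) ∧
        (∀ v : HeightOneSpectrum (𝓞 Kc) ⊕ (Kc →+* ℂ),
          (κ (m + 1) (g' : K (m + 1)) : Kc) ∈ Sum.elim (fun w => {x : Kc | x ≠ 0 ∧ w.valuation Kc x ≤ 1})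
            (fun φ => {x : Kc | x ≠ 0 ∧ ‖φ x‖ ≤ 1}) v)) :=
  Prop310ii_logKummer'_of_torsionTrivial_places κ _ toPermHom_modTorsion_eq_one_of_isOfFinOrder _
    fun _ _ _ h => h

end LogKummerPlaces

/-! ### (J1′) "… correspond, via the log-link, to addition by zero at `m + 1`" -/

section AdditionByZero

variable {K : Type u} [Field K] [NumberField K]

/-- A root of unity of a field lies in EVERY valuation subring of the field: if `y⁻¹ ∈ O` then
`y = (y⁻¹)^{n-1} ∈ O`. Elementary private helper for the junctions below. [folklore] -/
private theorem mem_valuationSubring_of_pow_eq_one {L : Type v} [Field L] (O : ValuationSubring L) {y : L}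
    {n : ℕ} (hn : n ≠ 0) (hy : y ^ n = 1) : y ∈ O := by
  rcases O.mem_or_inv_mem y with h | h
  · exact h
  · have hmul : y ^ (n - 1) * y = 1 := by rw [pow_sub_one_mul hn, hy]
    rw [eq_inv_of_mul_eq_one_right hmul, ← inv_pow]
    exact O.pow_mem h (n - 1)

/-- Places model, at ANY nonarchimedean localization: an element of the number field lying in every local
monoid becomes a UNIT of every valuation ring `O` of every field `L` receiving `K` (in particular of
`𝒪_{K_v} ⊆ K_v`) — it lies in the domain `O^×` of the log-link at that localization ([IUTchIII] Rmk. 1.1.1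
(i) p. 28; Rmk. 1.2.2 (i) p. 36: `log_k : 𝒪_k^× → k`). [claim: Mochizuki2012, status: disputed] -/
theorem exists_unit_valuationSubring_eq_of_mem_localMonoids_places {x : K}
    (hx : ∀ v : HeightOneSpectrum (𝓞 K) ⊕ (K →+* ℂ),
      x ∈ Sum.elim (fun w => {x : K | x ≠ 0 ∧ w.valuation K x ≤ 1})
        (fun φ => {x : K | x ≠ 0 ∧ ‖φ x‖ ≤ 1}) v)
    {L : Type v} [Field L] (i : K →+* L) (O : ValuationSubring L) :
    ∃ u : (↥O)ˣ, ((u : O) : L) = i x := by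
  obtain ⟨-, n, hn, hxn⟩ := exists_pow_eq_one_of_mem_localMonoids_places hx
  have hyn : i x ^ n = 1 := by rw [← map_pow, hxn, map_one]
  have hmem : i x ∈ O := mem_valuationSubring_of_pow_eq_one O hn.ne' hyn
  have hpow : (⟨i x, hmem⟩ : O) ^ n = 1 := Subtype.ext (by
    simp only [SubmonoidClass.coe_pow, OneMemClass.coe_one]; exact hyn)
  exact ⟨(IsUnit.of_pow_eq_one hpow hn.ne').unit, by rw [IsUnit.unit_spec]⟩

/-- **(J1′) [IUTchIII] Prop. 3.10 (ii), second paragraph — "addition by zero at `m + 1`"** ([IUTchIII] Prop.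
3.5 (ii) (c) p. 106, the local form of the same sentence: "indeterminacies at `m` that correspond, via the
log-link, to 'addition by zero' — i.e., to no indeterminacy! — at `m + 1`"; Rmk. 1.2.3 (i) p. 39: "if `H`
consists of roots of unity, then `log_k(H) = {0}`"): at the places model, an element of the number field lying
in every local monoid is sent to `0` by EVERY logarithm `log_k : O^× → (L, +)` on the units of ANY valuation
ring `O` of ANY characteristic-zero field `L` receiving `K` (abc-iut-L6-t3's abstract `logk` of
`LocalLogShells`, of which the `p_v`-adic logarithm of `K_v` is the intended instance) — by the first display
(the element is a root of unity) and `log_eq_zero_of_pow_eq_one` (p403834) BY NAME. PROVED.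
[claim: Mochizuki2012, status: disputed] -/
theorem log_eq_zero_of_mem_localMonoids_places {x : K}
    (hx : ∀ v : HeightOneSpectrum (𝓞 K) ⊕ (K →+* ℂ),
      x ∈ Sum.elim (fun w => {x : K | x ≠ 0 ∧ w.valuation K x ≤ 1})
        (fun φ => {x : K | x ≠ 0 ∧ ‖φ x‖ ≤ 1}) v)
    {L : Type v} [Field L] [CharZero L] (i : K →+* L) (O : ValuationSubring L)
    (logk : Additive (↥O)ˣ →+ L) (u : (↥O)ˣ) (hu : ((u : O) : L) = i x) :
    logk (Additive.ofMul u) = 0 := by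
  obtain ⟨-, n, hn, hxn⟩ := exists_pow_eq_one_of_mem_localMonoids_places hx
  have hun : u ^ n = 1 := by
    apply Units.ext
    apply Subtype.ext
    simp only [Units.val_pow_eq_pow_val, SubmonoidClass.coe_pow, hu, Units.val_one, OneMemClass.coe_one]
    rw [← map_pow, hxn, map_one]
  exact log_eq_zero_of_pow_eq_one O logk u hn.ne' hun

/-- **(J1′) at the completion `K_v`** ([IUTchIII] Rmk. 1.2.2 (i) p. 36: `k := K_v`, `log_k : 𝒪_k^× → k`): for
every finite place `v`, an element of the number field lying in every local monoid is a unit of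
`𝒪_{K_v} = v.adicCompletionIntegers K` and EVERY logarithm `𝒪_{K_v}^× → (K_v, +)` sends it to `0` — the log-link
`(n, m) → (n, m+1)` at `v` turns the multiplicative "identity indeterminacy" into "addition by zero". PROVED.
[claim: Mochizuki2012, status: disputed] -/
theorem adicCompletion_log_eq_zero_of_mem_localMonoids_places {x : K}
    (hx : ∀ v : HeightOneSpectrum (𝓞 K) ⊕ (K →+* ℂ),
      x ∈ Sum.elim (fun w => {x : K | x ≠ 0 ∧ w.valuation K x ≤ 1})
        (fun φ => {x : K | x ≠ 0 ∧ ‖φ x‖ ≤ 1}) v)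
    (v : HeightOneSpectrum (𝓞 K))
    (logk : Additive (↥(v.adicCompletionIntegers K))ˣ →+ v.adicCompletion K)
    (u : (↥(v.adicCompletionIntegers K))ˣ)
    (hu : ((u : v.adicCompletionIntegers K) : v.adicCompletion K) = algebraMap K (v.adicCompletion K) x) :
    logk (Additive.ofMul u) = 0 :=
  haveI : CharZero (v.adicCompletion K) :=
    charZero_of_injective_algebraMap (algebraMap K (v.adicCompletion K)).injective
  log_eq_zero_of_mem_localMonoids_places hx (algebraMap K (v.adicCompletion K))
    (v.adicCompletionIntegers K) logk u hu

/-- … and the unit of `𝒪_{K_v}` over the element EXISTS (so the previous statement is not vacuous). PROVED.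
[claim: Mochizuki2012, status: disputed] -/
theorem exists_unit_adicCompletionIntegers_eq_of_mem_localMonoids_places {x : K}
    (hx : ∀ v : HeightOneSpectrum (𝓞 K) ⊕ (K →+* ℂ),
      x ∈ Sum.elim (fun w => {x : K | x ≠ 0 ∧ w.valuation K x ≤ 1})
        (fun φ => {x : K | x ≠ 0 ∧ ‖φ x‖ ≤ 1}) v)
    (v : HeightOneSpectrum (𝓞 K)) :
    ∃ u : (↥(v.adicCompletionIntegers K))ˣ,
      ((u : v.adicCompletionIntegers K) : v.adicCompletion K) = algebraMap K (v.adicCompletion K) x :=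
  exists_unit_valuationSubring_eq_of_mem_localMonoids_places hx _ _

end AdditionByZero

/-! ### (J2) The parenthetical inclusion `(†𝕄⊛μ_MOD)_α ⊆ Π_{v∈𝕍} 𝓘^ℚ(^{A,α}𝓕_v)`, factor by factor -/

section ParentheticalInclusion

variable {K : Type u} [Field K] [NumberField K]

/-- **(J2, nonarchimedean factor) [IUTchIII] Prop. 3.10 (ii), first display, parenthetical inclusion**
`⊆ Π_{v∈𝕍} 𝓘^ℚ(^{A,α}𝓕_v)` (p. 148 l. 96–101), at a finite place `v`: an element of the number field lying in
every local monoid lands in the local integers `𝒪_{K_v} = v.adicCompletionIntegers K` of the completion — whence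
in the log-shell and its span by [IUTchIII] Rmk. 1.2.2 (i) (b^non) "`𝒪_k ⊆ 𝓘_k`" (abc-iut-L6-t3's
`IntegersSubsetLogShell` / abc-iut-L4-t3's `closedBall_subset_logShell`) and `𝓘^ℚ = K_v` (p412771
`shellQSpan_closure_logShell_eq_top`), cited BY NAME. PROVED. [claim: Mochizuki2012, status: disputed] -/
theorem algebraMap_adicCompletion_mem_integers_of_mem_localMonoids_places {x : K}
    (hx : ∀ v : HeightOneSpectrum (𝓞 K) ⊕ (K →+* ℂ),
      x ∈ Sum.elim (fun w => {x : K | x ≠ 0 ∧ w.valuation K x ≤ 1})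
        (fun φ => {x : K | x ≠ 0 ∧ ‖φ x‖ ≤ 1}) v)
    (v : HeightOneSpectrum (𝓞 K)) :
    algebraMap K (v.adicCompletion K) x ∈ v.adicCompletionIntegers K := by
  obtain ⟨-, n, hn, hxn⟩ := exists_pow_eq_one_of_mem_localMonoids_places hx
  exact mem_valuationSubring_of_pow_eq_one _ hn.ne' (by rw [← map_pow, hxn, map_one])

/-- **(J2, archimedean factor) [IUTchIII] Prop. 3.10 (ii), first display, parenthetical inclusion** at an
archimedean place: under every complex embedding an element lying in every local monoid lands in the
archimedean log-shell `𝓘_k = {a ∈ k | |a| ≤ π}` ([IUTchIII] Rmk. 1.2.2 (ii) p. 36: `𝒪_k^× ⊆ 𝒪_k ⊆ 𝓘_k`,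
abc-iut-L6-t3's `arcUnits_subset_arcIntegers`, `arcIntegers_subset_arcLogShell` BY NAME). PROVED.
[claim: Mochizuki2012, status: disputed] -/
theorem embedding_mem_arcLogShell_of_mem_localMonoids_places {x : K}
    (hx : ∀ v : HeightOneSpectrum (𝓞 K) ⊕ (K →+* ℂ),
      x ∈ Sum.elim (fun w => {x : K | x ≠ 0 ∧ w.valuation K x ≤ 1})
        (fun φ => {x : K | x ≠ 0 ∧ ‖φ x‖ ≤ 1}) v)
    (φ : K →+* ℂ) : φ x ∈ arcLogShell :=
  arcIntegers_subset_arcLogShell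
    (arcUnits_subset_arcIntegers (norm_embedding_eq_one_of_mem_localMonoids_places hx φ))

/-- `𝓘^ℚ_k = k` at a complex archimedean place: the span (abc-iut-L6-t4's `shellQSpan`, "the `ℚ`-span of `𝓘`",
[IUTchIII] Prop. 3.2 (ii) p. 99 — read over `ℝ`, as its docstring prescribes "for the closed unit ball of a
normed `ℝ`-space") of the subgroup generated by the archimedean log-shell `𝓘_k = {|a| ≤ π} ⊆ ℂ` is ALL of `ℂ`:
every `z` is `(‖z‖ + 1) · (z / (‖z‖ + 1))` with `|z / (‖z‖ + 1)| < 1 ≤ π`. The archimedean twin of p412771's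
`shellQSpan_closure_logShell_eq_top`. PROVED. [claim: Mochizuki2012, status: disputed] -/
theorem arcShellQSpan_eq_top : shellQSpan ℝ (AddSubgroup.closure arcLogShell) = (⊤ : Submodule ℝ ℂ) := by
  refine Submodule.eq_top_iff'.mpr fun z => ?_
  have hc : 0 < ‖z‖ + 1 := by positivity
  have hw : (‖z‖ + 1)⁻¹ • z ∈ arcLogShell := by
    refine arcIntegers_subset_arcLogShell ?_
    show ‖(‖z‖ + 1)⁻¹ • z‖ ≤ 1
    rw [norm_smul, norm_inv, Real.norm_of_nonneg hc.le, inv_mul_le_iff₀ hc]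
    linarith
  have hmem : (‖z‖ + 1)⁻¹ • z ∈ shellQSpan ℝ (AddSubgroup.closure arcLogShell) :=
    shell_le_shellQSpan ℝ _ (AddSubgroup.subset_closure hw)
  have h := Submodule.smul_mem _ (‖z‖ + 1) hmem
  rwa [smul_smul, mul_inv_cancel₀ hc.ne', one_smul] at h

/-- **(J2, archimedean factor, `𝓘^ℚ` form)**: under every complex embedding an element lying in every local
monoid lies in `𝓘^ℚ_k` (read, as in abc-iut-L6-t4's `Prop35ii_c` shape, as a `ℤ`-submodule of the coric field).
PROVED. [claim: Mochizuki2012, status: disputed] -/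
theorem embedding_mem_arcShellQSpan_of_mem_localMonoids_places {x : K}
    (hx : ∀ v : HeightOneSpectrum (𝓞 K) ⊕ (K →+* ℂ),
      x ∈ Sum.elim (fun w => {x : K | x ≠ 0 ∧ w.valuation K x ≤ 1})
        (fun φ => {x : K | x ≠ 0 ∧ ‖φ x‖ ≤ 1}) v)
    (φ : K →+* ℂ) :
    φ x ∈ (shellQSpan ℝ (AddSubgroup.closure arcLogShell)).restrictScalars ℤ := by
  rw [Submodule.restrictScalars_mem]
  exact shell_le_shellQSpan ℝ _
    (AddSubgroup.subset_closure (embedding_mem_arcLogShell_of_mem_localMonoids_places hx φ))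

end ParentheticalInclusion

end Literature.IUT.LogThetaLattice

end
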